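import Summits.CriticalPhenomena.PercolationContinuityZ3.Theorems.Transplant.GrigorchukLamplighterSubexponentialGrowth
import Summits.CriticalPhenomena.PercolationContinuityZ3.Theorems.Transplant.GrigorchukSubexponentialGrowthAllGens
import Summits.CriticalPhenomena.PercolationContinuityZ3.Theorems.Transplant.SiteBurtonKeaneQT
import HarnessLib

/-!
# UNIQUENESS OF THE INFINITE CLUSTER AT EVERY DENSITY on the Cayley graphs of the first Grigorchuk group `𝔊` and of Bartholdi–Erschler's
# `Γ₂ = ℤ ≀_X 𝔊` (Burton–Keane for amenable quasi-transitive graphs — bond and site)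

builds on p205010 (kernel theorem, internal audit signed; external expert review pending) — nothing in this file uses p205010.  Lane `prim-bschramm`, seat
`prim-bschramm-gen-1` gen 9 (GEN pen; offer O-BE4).  DEF-FREE helper file (`--supports stmt-CriticalPhenomena-4575 --as helper`); no instance, no notation, no `@[conjecture]`.
CUSTOMERS ONLY — every theorem is a one-line application of a tree theorem to a kernel-verified amenability: Literature «SubexponentialGrowthZdBurtonKeane»
`BurtonKeane1989_atMostOneInfiniteCluster_holds` (bond) and «SiteBurtonKeaneQT» `SiteUniqQT.sitePercolation_ae_unique_infinite_siteCluster_of_isGraphAmenable` (site),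
fed with «GrigorchukSubexponentialGrowthAllGens» p613200 `isGraphAmenable_cayley_gens` (every Cayley graph of `𝔊`) and F-BE3 «GrigorchukLamplighterSubexponentialGrowth»
`cayley_gens_isGraphAmenable` (every Cayley graph of `Γ₂`); connectedness / quasi-transitivity from «CayleyMilnorKernel».  Nothing restated.
STATEMENTS: on `Cay(𝔊; S)` and on `Cay(Γ₂; S)`, `S` finite generating, at EVERY density `p ∈ [0,1]`: bond percolation has a.s. at most one infinite cluster; in site
percolation a.s. any two infinite site clusters are connected in the open subgraph.  In print: Burton–Keane 1989 / Häggström 2011 Thm. 2.6 for amenable quasi-transitive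
graphs, amenability from subexponential growth (Grigorchuk 1984 for `𝔊`, Bartholdi–Erschler 2012 for `Γ₂`) — 'kernel', no novelty.  Nothing about `θ(p_c)` on either
graph, no node touched, nothing about `BenjaminiSchramm1996_conj4_endState`.
[cite: BurtonKeane1989, Thm. 2] [cite: Haggstrom2011, Thm. 2.6] [cite: LyonsPeres2016, Thm. 7.6] [cite: Grigorchuk1984, Thm.] [cite: BartholdiErschler2012, Thm. 5.3]
-/

noncomputable section

namespace Summit.CriticalPhenomena.PercolationContinuityZ3.Theorems.Transplant
namespace Grigorchuk

open SimpleGraph MeasureTheory Literature.Barriers.CriticalPhenomena Literature.Probability.Percolation Literature.Probability.LatticeModels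
open scoped Classical

/-! ## §1 The first Grigorchuk group -/

/-- **At most one infinite cluster, a.s., at EVERY density on EVERY Cayley graph `Cay(𝔊; S)`** (`S` finite generating) — Burton–Keane for the amenable quasi-transitive
graph `Cay(𝔊; S)`. [cite: BurtonKeane1989, Thm. 2] [cite: LyonsPeres2016, Thm. 7.6] [cite: Grigorchuk1984, Thm. (subexponential growth)] -/
theorem grigorchuk_cayley_gens_numInfiniteClusters_le_one (S : Finset ↥grigorchukGroup) (hS : Subgroup.closure (↑S : Set ↥grigorchukGroup) = ⊤) (p : unitInterval) :
    ∀ᵐ ω ∂(bondPercolation (mulCayley (↑S : Set ↥grigorchukGroup)) p), numInfiniteClusters ω ≤ 1 :=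
  BurtonKeane1989_atMostOneInfiniteCluster_holds _ (CayleyScaled.connected_mulCayley_of_closure S hS) (CayleyScaled.isQuasiTransitive_mulCayley S)
    (isGraphAmenable_cayley_gens S) p

/-- **Site version on `Cay(𝔊; S)`: a.s. any two infinite site clusters are connected** (Häggström's site Burton–Keane for amenable quasi-transitive graphs).
[cite: Haggstrom2011, Thm. 2.6] [cite: BurtonKeane1989, Thm. 2] -/
theorem grigorchuk_cayley_gens_site_unique (S : Finset ↥grigorchukGroup) (hS : Subgroup.closure (↑S : Set ↥grigorchukGroup) = ⊤) (p : unitInterval) :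
    ∀ᵐ σ ∂(sitePercolation ↥grigorchukGroup p), ∀ x y, (siteCluster (mulCayley (↑S : Set ↥grigorchukGroup)) σ x).Infinite →
      (siteCluster (mulCayley (↑S : Set ↥grigorchukGroup)) σ y).Infinite → (siteOpenGraph (mulCayley (↑S : Set ↥grigorchukGroup)) σ).Reachable x y :=
  SiteUniqQT.sitePercolation_ae_unique_infinite_siteCluster_of_isGraphAmenable (CayleyScaled.connected_mulCayley_of_closure S hS)
    (CayleyScaled.isQuasiTransitive_mulCayley S) (isGraphAmenable_cayley_gens S) p

/-! ## §2 Bartholdi–Erschler's `Γ₂ = ℤ ≀_X 𝔊` -/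

/-- **At most one infinite cluster, a.s., at EVERY density on EVERY Cayley graph `Cay(Γ₂; S)`** (`S` finite generating; in particular on Bartholdi–Erschler's
`Cay(ℤ ≀_X 𝔊; a, b, c, d, s)`) — Burton–Keane for the amenable quasi-transitive graph `Cay(Γ₂; S)` (amenability: F-BE3). [cite: BurtonKeane1989, Thm. 2] [cite: LyonsPeres2016, Thm. 7.6]
[cite: BartholdiErschler2012, Thm. 5.3] -/
theorem cayley_gens_numInfiniteClusters_le_one (S : Finset ↥wreathZ) (hS : Subgroup.closure (↑S : Set ↥wreathZ) = ⊤) (p : unitInterval) :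
    ∀ᵐ ω ∂(bondPercolation (mulCayley (↑S : Set ↥wreathZ)) p), numInfiniteClusters ω ≤ 1 :=
  BurtonKeane1989_atMostOneInfiniteCluster_holds _ (CayleyScaled.connected_mulCayley_of_closure S hS) (CayleyScaled.isQuasiTransitive_mulCayley S)
    (cayley_gens_isGraphAmenable S) p

/-- **… in particular on `Cay(ℤ ≀_X 𝔊; a, b, c, d, s)` itself.** [cite: BurtonKeane1989, Thm. 2] [cite: BartholdiErschler2012, §2, Thm. 5.3] -/
theorem cay_numInfiniteClusters_le_one (p : unitInterval) : ∀ᵐ ω ∂(bondPercolation (mulCayley (↑stdGens : Set ↥wreathZ)) p), numInfiniteClusters ω ≤ 1 :=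
  cayley_gens_numInfiniteClusters_le_one stdGens closure_standardGens_finset p

/-- **Site version on `Cay(Γ₂; S)`: a.s. any two infinite site clusters are connected.** [cite: Haggstrom2011, Thm. 2.6] [cite: BurtonKeane1989, Thm. 2] -/
theorem cayley_gens_site_unique (S : Finset ↥wreathZ) (hS : Subgroup.closure (↑S : Set ↥wreathZ) = ⊤) (p : unitInterval) :
    ∀ᵐ σ ∂(sitePercolation ↥wreathZ p), ∀ x y, (siteCluster (mulCayley (↑S : Set ↥wreathZ)) σ x).Infinite →
      (siteCluster (mulCayley (↑S : Set ↥wreathZ)) σ y).Infinite → (siteOpenGraph (mulCayley (↑S : Set ↥wreathZ)) σ).Reachable x y :=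
  SiteUniqQT.sitePercolation_ae_unique_infinite_siteCluster_of_isGraphAmenable (CayleyScaled.connected_mulCayley_of_closure S hS)
    (CayleyScaled.isQuasiTransitive_mulCayley S) (cayley_gens_isGraphAmenable S) p

end Grigorchuk
end Summit.CriticalPhenomena.PercolationContinuityZ3.Theorems.Transplant
end
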